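import Mathlib
import HarnessLib
import Literature.Analysis.FluidPDE.SelfSimilar
import Literature.Analysis.FluidPDE.TypeIAncientMild
import Summits.NavierStokesRegularity.NavierStokesRegularity.Theorems.QuarterLogPincerThinCascadeDefs
import Summits.NavierStokesRegularity.NavierStokesRegularity.Theorems.QuarterLogPincerTruncationEdgeDivFreeTruncation
import Summits.NavierStokesRegularity.NavierStokesRegularity.Theorems.QuarterLogPincerTruncationEdgeAnatomyDefs

/-!
# Crux `QuarterLogPincer.TypeIQuantSubcubicExp` (stmt-NavierStokesRegularity-24077), EDGE line `truncation_edge` (ns-idea-7 g8/g9):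
# piece **P1 `stub_cutoffData : StubCutoffData` BY NAME** — cut-off data for an enveloped Type-I ancient mild field

Prover file (pub-ns-dss typer g35; `--supports stmt-NavierStokesRegularity-24077`, helper).  The line's v1.4 anatomy cuts its one
remaining input T1 into P1 ∧ P2 ∧ P3 ∧ P4 (`stubFarFieldTruncation_of_anatomy` in the workfile; objects re-homed VERBATIM in
`…TruncationEdgeAnatomyDefs`).  P1 `CutoffData v` asks, for every radius `ρ ≥ 1`, for a smooth, divergence-free, compactly supported
datum `u₀` with `tsupport u₀ ⊆ B̄(2ρ)`, `sup‖u₀ − v(−1)‖ ≤ K/ρ` and energy `‖u₀‖₂² ≤ Kρ`.  It is discharged here WITHOUT Bogovskiĭ: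
the cone-potential truncation `exists_divFree_truncation` (`…TruncationEdgeDivFreeTruncation`, p665196: `u₀ = curl(ζ_ρ · conePotential
v(−1))`, `‖u₀ − v(−1)‖_∞ ≤ K₁A/ρ`) plus the energy count `lintegral_enorm_sq_le_of_envelope_support` (polar coordinates; on `B̄(2ρ)`,
`|u₀| ≤ A/(|x|+1) + K₁A/ρ`, whence `‖u₀‖₂² ≤ (24πA² + 72π(K₁A)²)ρ`).  Constant `K := K₁A + 24πA² + 72π(K₁A)²`.

HONEST FRAME: support lemma about hypothetical objects; T1 (= P1 ∧ P2 ∧ P3 ∧ P4, open: P3b localisation), 24077, 22144, W7 and NS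
regularity OPEN / not proved.
-/

noncomputable section

set_option linter.dupNamespace false

namespace Summit.NavierStokesRegularity.NavierStokesRegularity.Cruxes.TypeIQuantSubcubicExp.TruncationEdge

open MeasureTheory Set Function Metric Filter Topology Real
open scoped ENNReal NNReal ContDiff
open Literature.Analysis Literature.Analysis.FluidPDE
open Summit.NavierStokesRegularity.NavierStokesRegularity.Cruxes.TypeIQuantSubcubicExp.ThinCascade (TaoFrame)
open Summit.NavierStokesRegularity.NavierStokesRegularity.Theorems.QuarterLogPincerTruncationEdge
  (exists_divFree_truncation)

/-! ## The energy of an enveloped, compactly supported datum -/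

/-- Radial energy budget: `∫_{(0,∞)} r² 𝟙_{r<R} (a/(r+1)² + c) dr ≤ aR + cR³/3` (`a, c, R ≥ 0`). [folklore] -/
theorem setIntegral_Ioi_sq_mul_indicator_energy_le {a c R : ℝ} (ha : 0 ≤ a) (hR : 0 ≤ R) :
    ∫ r in Ioi (0 : ℝ), r ^ (3 - 1) • (Iio R).indicator (fun r => a / (r + 1) ^ 2 + c) r ≤
      a * R + c * R ^ 3 / 3 := by
  have hfun : (fun r : ℝ => r ^ (3 - 1) • (Iio R).indicator (fun r => a / (r + 1) ^ 2 + c) r) =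
      (Iio R).indicator (fun r => r ^ 2 * (a / (r + 1) ^ 2 + c)) := by
    funext r
    by_cases hr : r ∈ Iio R
    · simp [indicator_of_mem hr]
    · simp [indicator_of_notMem hr]
  rw [hfun, integral_indicator measurableSet_Iio, Measure.restrict_restrict measurableSet_Iio, Iio_inter_Ioi]
  have hcont : ∀ {g : ℝ → ℝ}, ContinuousOn g (Icc 0 R) → IntegrableOn g (Ioo 0 R) := fun hg =>
    (hg.integrableOn_compact isCompact_Icc).mono_set Ioo_subset_Icc_self
  have hden : ∀ r ∈ Icc (0 : ℝ) R, (r + 1) ^ 2 ≠ 0 := fun r hr => by have := hr.1; positivity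
  have hc1 : ContinuousOn (fun r : ℝ => r ^ 2 * (a / (r + 1) ^ 2 + c)) (Icc 0 R) :=
    (continuousOn_id.pow 2).mul ((continuousOn_const.div ((continuousOn_id.add continuousOn_const).pow 2) hden).add
      continuousOn_const)
  have hc2 : ContinuousOn (fun r : ℝ => a + c * r ^ 2) (Icc 0 R) := continuousOn_const.add (continuousOn_const.mul (continuousOn_id.pow 2))
  calc ∫ r in Ioo 0 R, r ^ 2 * (a / (r + 1) ^ 2 + c)
      ≤ ∫ r in Ioo 0 R, (a + c * r ^ 2) := by
        refine setIntegral_mono_on (hcont hc1) (hcont hc2) measurableSet_Ioo fun r hr => ?_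
        have hr0 : 0 ≤ r := hr.1.le
        have h1 : r ^ 2 * (a / (r + 1) ^ 2) ≤ a := by
          rw [← mul_div_assoc, div_le_iff₀ (by positivity)]
          nlinarith [mul_nonneg ha hr0]
        nlinarith [h1, sq_nonneg r]
    _ = a * R + c * R ^ 3 / 3 := by
        rw [← integral_Ioc_eq_integral_Ioo, ← intervalIntegral.integral_of_le hR]
        have hi1 : IntervalIntegrable (fun _ : ℝ => a) volume 0 R := intervalIntegrable_const
        have hi2 : IntervalIntegrable (fun x : ℝ => c * x ^ 2) volume 0 R :=
          (continuous_const.mul (continuous_id.pow 2)).intervalIntegrable 0 R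
        rw [intervalIntegral.integral_add hi1 hi2, intervalIntegral.integral_const,
          intervalIntegral.integral_const_mul, integral_pow]
        simp
        ring

/-- Energy of a field supported in `B̄(2ρ)` and dominated by `A/(‖x‖+1) + B/ρ` there:
`∫⁻ ‖u₀‖ₑ² ≤ ofReal((24πA² + 72πB²)ρ)` for `ρ ≥ 1`. [folklore] -/
theorem lintegral_enorm_sq_le_of_envelope_support {u₀ : EuclideanSpace ℝ (Fin 3) → EuclideanSpace ℝ (Fin 3)}
    {A B ρ : ℝ} (hρ : 1 ≤ ρ) (hzero : ∀ x, 2 * ρ < ‖x‖ → u₀ x = 0)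
    (hbd : ∀ x, ‖u₀ x‖ ≤ A / (‖x‖ + 1) + B / ρ) :
    ∫⁻ x, ‖u₀ x‖ₑ ^ 2 ≤ ENNReal.ofReal ((24 * π * A ^ 2 + 72 * π * B ^ 2) * ρ) := by
  have hρ0 : 0 < ρ := by linarith
  set R : ℝ := 2 * ρ + 1 with hR
  have hR0 : 0 ≤ R := by positivity
  -- the radial majorant
  set a : ℝ := 2 * A ^ 2 with ha
  set c : ℝ := 2 * B ^ 2 / ρ ^ 2 with hc
  have ha0 : 0 ≤ a := by positivity
  set g : EuclideanSpace ℝ (Fin 3) → ℝ := fun x => (ball (0 : EuclideanSpace ℝ (Fin 3)) R).indicator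
    (fun x => a / (‖x‖ + 1) ^ 2 + c) x with hg
  have hpt : ∀ x, ‖u₀ x‖ ^ 2 ≤ g x := by
    intro x
    by_cases hx : x ∈ ball (0 : EuclideanSpace ℝ (Fin 3)) R
    · rw [hg]; simp only [indicator_of_mem hx]
      have h1 := hbd x
      have hn : 0 ≤ ‖u₀ x‖ := norm_nonneg _
      have hd : 0 < ‖x‖ + 1 := by positivity
      -- `(p+q)² ≤ 2p² + 2q²`
      calc ‖u₀ x‖ ^ 2 ≤ (A / (‖x‖ + 1) + B / ρ) ^ 2 := pow_le_pow_left₀ hn h1 2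
        _ ≤ 2 * (A / (‖x‖ + 1)) ^ 2 + 2 * (B / ρ) ^ 2 := by nlinarith [sq_nonneg (A / (‖x‖ + 1) - B / ρ)]
        _ = a / (‖x‖ + 1) ^ 2 + c := by rw [ha, hc, div_pow, div_pow]; ring
    · have hx' : 2 * ρ < ‖x‖ := by
        rw [mem_ball_zero_iff, not_lt] at hx; linarith
      rw [hzero x hx', norm_zero]; simp only [ne_eq, OfNat.ofNat_ne_zero, not_false_eq_true, zero_pow]
      rw [hg]; simp only [indicator_of_notMem hx]; exact le_rfl
  -- integrability and the value of the majorant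
  have hne : ∀ x : EuclideanSpace ℝ (Fin 3), (‖x‖ + 1) ^ 2 ≠ 0 := fun x => by positivity
  have hgc : Continuous fun x : EuclideanSpace ℝ (Fin 3) => a / (‖x‖ + 1) ^ 2 + c :=
    (continuous_const.div ((continuous_norm.add continuous_const).pow 2) hne).add continuous_const
  have hgi : Integrable g := by
    rw [hg]
    exact (integrable_indicator_iff measurableSet_ball).2
      ((hgc.continuousOn.integrableOn_compact (isCompact_closedBall (0 : EuclideanSpace ℝ (Fin 3)) R)).mono_set
        ball_subset_closedBall)
  have hgnn : 0 ≤ᵐ[volume] g := Eventually.of_forall fun x => (sq_nonneg _).trans (hpt x)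
  have hgval : ∫ x, g x ≤ 4 * π * (a * R + c * R ^ 3 / 3) := by
    have hfun : g = fun x : EuclideanSpace ℝ (Fin 3) => (Iio R).indicator (fun r => a / (r + 1) ^ 2 + c) ‖x‖ := by
      funext x
      by_cases hx : x ∈ ball (0 : EuclideanSpace ℝ (Fin 3)) R
      · have hx' : ‖x‖ ∈ Iio R := by simpa using hx
        rw [hg]; simp only [indicator_of_mem hx, indicator_of_mem hx']
      · have hx' : ‖x‖ ∉ Iio R := by simpa using hx
        rw [hg]; simp only [indicator_of_notMem hx, indicator_of_notMem hx']
    rw [hfun, integral_fun_norm_addHaar (volume : Measure (EuclideanSpace ℝ (Fin 3)))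
      ((Iio R).indicator (fun r => a / (r + 1) ^ 2 + c)),
      finrank_euclideanSpace_fin, measureReal_def, EuclideanSpace.volume_ball_fin_three, nsmul_eq_mul, smul_eq_mul]
    have hvol : (ENNReal.ofReal (1 : ℝ) ^ 3 * ENNReal.ofReal (π * 4 / 3)).toReal = π * 4 / 3 := by
      rw [ENNReal.ofReal_one, one_pow, one_mul, ENNReal.toReal_ofReal (by positivity)]
    rw [hvol]
    have h1 := setIntegral_Ioi_sq_mul_indicator_energy_le (c := c) ha0 hR0
    have hπ : (0 : ℝ) ≤ π * 4 / 3 := by positivity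
    calc (3 : ℕ) * (π * 4 / 3 * ∫ r in Ioi (0 : ℝ), r ^ (3 - 1) • (Iio R).indicator (fun r => a / (r + 1) ^ 2 + c) r)
        ≤ (3 : ℕ) * (π * 4 / 3 * (a * R + c * R ^ 3 / 3)) := by gcongr
      _ = 4 * π * (a * R + c * R ^ 3 / 3) := by push_cast; ring
  -- `R ≤ 3ρ`
  have hR3 : R ≤ 3 * ρ := by rw [hR]; linarith
  have hfinal : 4 * π * (a * R + c * R ^ 3 / 3) ≤ (24 * π * A ^ 2 + 72 * π * B ^ 2) * ρ := by
    have h1 : a * R ≤ 2 * A ^ 2 * (3 * ρ) := by rw [ha]; exact mul_le_mul_of_nonneg_left hR3 (by positivity)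
    have h2 : c * R ^ 3 / 3 ≤ 2 * B ^ 2 / ρ ^ 2 * (3 * ρ) ^ 3 / 3 := by
      rw [hc]; gcongr
    have h3 : 2 * B ^ 2 / ρ ^ 2 * (3 * ρ) ^ 3 / 3 = 18 * B ^ 2 * ρ := by
      field_simp; ring
    nlinarith [pi_pos.le, h1, h2, h3, mul_nonneg pi_pos.le (sq_nonneg A)]
  calc ∫⁻ x, ‖u₀ x‖ₑ ^ 2 = ∫⁻ x, ENNReal.ofReal (‖u₀ x‖ ^ 2) := by
        refine lintegral_congr fun x => ?_
        rw [← ofReal_norm, ENNReal.ofReal_pow (norm_nonneg _)]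
    _ ≤ ∫⁻ x, ENNReal.ofReal (g x) := lintegral_mono fun x => ENNReal.ofReal_le_ofReal (hpt x)
    _ = ENNReal.ofReal (∫ x, g x) := (ofReal_integral_eq_lintegral_ofReal hgi hgnn).symm
    _ ≤ ENNReal.ofReal ((24 * π * A ^ 2 + 72 * π * B ^ 2) * ρ) := ENNReal.ofReal_le_ofReal (hgval.trans hfinal)

/-! ## P1 by name -/

/-- **P1 BY NAME — `stub_cutoffData : StubCutoffData`** (piece P1 of the T1 anatomy of line `truncation_edge`, author ns-idea-7 g9,
objects in `…TruncationEdgeAnatomyDefs`): for an enveloped Type-I ancient mild field, cut-off data at every radius `ρ ≥ 1` — smooth,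
divergence free, compactly supported in `B̄(2ρ)`, `K/ρ`-close to `v(−1)` in sup norm, energy `≤ Kρ`.  Discharged WITHOUT Bogovskiĭ by
the cone-potential truncation `exists_divFree_truncation` (`…TruncationEdgeDivFreeTruncation`, p665196) and the energy count
`lintegral_enorm_sq_le_of_envelope_support` (polar coordinates: `|u₀| ≤ A/(|x|+1) + K₁A/ρ` on `B̄(2ρ)`).
`K := K₁A + 24πA² + 72π(K₁A)²`. [this file; line piece P1 discharged] -/
theorem stub_cutoffData : StubCutoffData := by
  intro M A v hA hv hdec
  obtain ⟨K₁, hK₁, htr⟩ := exists_divFree_truncation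
  have hv1s : ContDiff ℝ ∞ (v (-1)) := hv.contDiff_slice (by norm_num)
  have hv1d : ∀ y, VectorCalculus.divergence (v (-1)) y = 0 := hv.isDivFree (by norm_num)
  have hv1e : ∀ x, ‖v (-1) x‖ ≤ A / (‖x‖ + 1) := fun x => by
    have := hdec (-1) (by norm_num) x
    simpa using this
  refine ⟨K₁ * A + (24 * π * A ^ 2 + 72 * π * (K₁ * A) ^ 2), by positivity, fun ρ hρ => ?_⟩
  have hρ0 : 0 < ρ := by linarith
  obtain ⟨u₀, hs, hd, hc, hz, -, herr⟩ := htr hv1s hv1d hA hv1e hρ0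
  refine ⟨u₀, hs, hd, hc, ?_, ?_, ?_⟩
  · -- support
    refine closure_minimal (fun x hx => ?_) isClosed_closedBall
    rw [mem_closedBall_zero_iff]
    by_contra h
    push Not at h
    exact hx (hz x h)
  · -- sup closeness
    intro x
    refine (herr x).trans ?_
    rw [div_le_div_iff_of_pos_right hρ0]
    have : 0 ≤ 24 * π * A ^ 2 + 72 * π * (K₁ * A) ^ 2 := by positivity
    linarith
  · -- energy
    have hbd : ∀ x, ‖u₀ x‖ ≤ A / (‖x‖ + 1) + K₁ * A / ρ := fun x =>
      calc ‖u₀ x‖ ≤ ‖v (-1) x‖ + ‖u₀ x - v (-1) x‖ := norm_le_insert' _ _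
        _ ≤ A / (‖x‖ + 1) + K₁ * A / ρ := add_le_add (hv1e x) (herr x)
    refine (lintegral_enorm_sq_le_of_envelope_support hρ hz hbd).trans (ENNReal.ofReal_le_ofReal ?_)
    have h1 : (0:ℝ) ≤ K₁ * A * ρ := by positivity
    nlinarith

end Summit.NavierStokesRegularity.NavierStokesRegularity.Cruxes.TypeIQuantSubcubicExp.TruncationEdge

end
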